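import Mathlib.Analysis.Calculus.FDeriv.Add
import Mathlib.Analysis.Calculus.FDeriv.Mul
import Mathlib.Geometry.Manifold.MFDeriv.SpecificFunctions
import Literature.Topology.FourManifolds.Morse
import HarnessLib

/-!
# Affine rescaling of Morse functions: `a · f + b`

Topic `Literature/Topology/FourManifolds` (trunk FourManL, notion `kirby_calculus_handles`;
fact seat `provefact-Literature.SPC4.exists_isMorse_isSelfIndexing`).  Milnor, *Lectures on the
h-cobordism theorem* (1965) normalises Morse functions on a triad to `f(W) = [0, 1]`
(Def. 3.1 with Thm. 4.1: *"If `f(W) = [0, 1]` …"*) and, for self-indexing functions, to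
`[-½, n + ½]` (Thm. 4.8, alternate version); the tree's cobordism files use the
`[0, 1]`-normalisation throughout (`Literature.Topology.FourManifolds.Cobordism.IsMorseFunction`, and
`Literature.Cobordism.niceLevel n k = (k + ½)/(n + 2)` for Milnor's critical value `k`,
`HCobordismEliminationSteps.lean`: *"the affine renormalisation `y ↦ (y + ½)/(dim W + 1)` …
(which preserves Morse functions, critical points and indices)"*).  This file proves that
parenthetical remark, for the chartwise Morse data of `Morse.lean` on any manifold (any model
with corners): for real constants `a ≠ 0`, `b`, the function `x ↦ a · f x + b`

* has chartwise derivative `a · df` and the same critical points as `f`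
  (`Literature.Topology.FourManifolds.mfderiv_const_mul_add`, `Literature.Topology.FourManifolds.isMCriticalPt_const_mul_add_iff`,
  `Literature.Topology.FourManifolds.criticalSet_const_mul_add`);
* has Hessian `a · Hess f` (`Literature.Topology.FourManifolds.mhessian_const_mul_add`), hence is Morse iff `f` is
  (`Literature.Topology.FourManifolds.IsMorse.const_mul_add`) and, for `a > 0`, has the same Morse index at every point
  (`Literature.Topology.FourManifolds.morseIndex_const_mul_add`, via `Literature.Topology.FourManifolds.sigNeg_smul`: the negative index of inertia is
  unchanged by a positive rescaling of the quadratic form) and the same critical points of each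
  index (`Literature.Topology.FourManifolds.IsMorse.criticalSetOfIndex_const_mul_add`).

(The orientation-reversing case `a - f` is `MorseTurnAbout.lean`.)

## References

* J. Milnor, *Lectures on the h-cobordism theorem*, Princeton Math. Notes (1965), Def. 3.1,
  Thm. 4.1, Thm. 4.8 (alternate version). [MilnorHCobordism1965]
-/

open scoped Manifold ContDiff Topology
open Set Function

noncomputable section

namespace Literature.Topology.FourManifolds

/-! ### Linear algebra: inertia indices under positive rescaling -/

section Signature

variable {V : Type*} [AddCommGroup V] [Module ℝ V]

/-- A positive multiple of a quadratic form is positive definite iff the form is. [folklore] -/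
theorem posDef_smul_iff {a : ℝ} (ha : 0 < a) (Q : QuadraticForm ℝ V) :
    (a • Q).PosDef ↔ Q.PosDef := by
  simp only [QuadraticMap.PosDef, QuadraticMap.smul_apply, smul_eq_mul]
  exact forall₂_congr fun x _ => mul_pos_iff_of_pos_left ha

/-- Restriction commutes with rescaling. [folklore] -/
theorem restrict_smul (a : ℝ) (Q : QuadraticForm ℝ V) (W : Submodule ℝ V) :
    (a • Q).restrict W = a • Q.restrict W := by
  ext x; rfl

/-- **The positive index of inertia is unchanged by a positive rescaling.** [folklore] -/
theorem sigPos_smul [Module.Finite ℝ V] {a : ℝ} (ha : 0 < a) (Q : QuadraticForm ℝ V) :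
    sigPos (a • Q) = sigPos Q := by
  refine (sigPos_isGreatest (a • Q)).unique ?_
  have hset : {r | ∃ W : Submodule ℝ V, Module.finrank ℝ W = r ∧ ((a • Q).restrict W).PosDef} =
      {r | ∃ W : Submodule ℝ V, Module.finrank ℝ W = r ∧ (Q.restrict W).PosDef} := by
    ext r
    simp only [mem_setOf_eq, restrict_smul, posDef_smul_iff ha]
  rw [hset]
  exact sigPos_isGreatest Q

/-- **The negative index of inertia is unchanged by a positive rescaling.** [folklore] -/
theorem sigNeg_smul [Module.Finite ℝ V] {a : ℝ} (ha : 0 < a) (Q : QuadraticForm ℝ V) :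
    sigNeg (a • Q) = sigNeg Q := by
  have h : -(a • Q) = a • (-Q) := by
    ext v; simp
  rw [← sigPos_neg, ← sigPos_neg, h, sigPos_smul ha]

end Signature

/-! ### Chartwise calculus of `a · f + b` -/

section General

variable {E H : Type*} [NormedAddCommGroup E] [NormedSpace ℝ E] [TopologicalSpace H]
  {I : ModelWithCorners ℝ E H} {M : Type*} [TopologicalSpace M] [ChartedSpace H M]

/-- `a · f + b` read in a chart is `a · (f read in the chart) + b`. [folklore] -/
theorem writtenInExtChartAt_const_mul_add (f : M → ℝ) (a b : ℝ) (x : M) :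
    writtenInExtChartAt I 𝓘(ℝ, ℝ) x (fun y => a * f y + b) =
      fun e => a * writtenInExtChartAt I 𝓘(ℝ, ℝ) x f e + b := by
  funext e
  simp [writtenInExtChartAt]

/-- On the range of the model, the chartwise derivative of `a · f + b` is `a` times that of `f`
(`a ≠ 0`; no differentiability needed). [folklore] -/
theorem fderivWithin_writtenInExtChartAt_const_mul_add (f : M → ℝ) {a : ℝ} (ha : a ≠ 0) (b : ℝ)
    (x : M) :
    EqOn (fderivWithin ℝ (writtenInExtChartAt I 𝓘(ℝ, ℝ) x (fun y => a * f y + b)) (range I))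
      (fun e => a • fderivWithin ℝ (writtenInExtChartAt I 𝓘(ℝ, ℝ) x f) (range I) e) (range I) := by
  intro e he
  haveI : Invertible a := invertibleOfNonzero ha
  rw [writtenInExtChartAt_const_mul_add, fderivWithin_add_const]
  exact fderivWithin_const_smul_of_invertible a (f := writtenInExtChartAt I 𝓘(ℝ, ℝ) x f)
    (I.uniqueDiffOn e he)

/-- **The Hessian of `a · f + b` is `a` times the Hessian of `f`** (`a ≠ 0`; chartwise Hessian
`Literature.Topology.FourManifolds.mhessian` of `Morse.lean`, at every point). [cite: MilnorHCobordism1965, Thm. 4.8 (alternate version; renormalisation)] -/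
theorem mhessian_const_mul_add (f : M → ℝ) {a : ℝ} (ha : a ≠ 0) (b : ℝ) (x : M) :
    mhessian I (fun y => a * f y + b) x = a • mhessian I f x := by
  haveI : Invertible a := invertibleOfNonzero ha
  have hx : extChartAt I x x ∈ range I := by simp
  have h1 : fderivWithin ℝ (fderivWithin ℝ (writtenInExtChartAt I 𝓘(ℝ, ℝ) x (fun y => a * f y + b))
      (range I)) (range I) (extChartAt I x x) =
      a • fderivWithin ℝ (fderivWithin ℝ (writtenInExtChartAt I 𝓘(ℝ, ℝ) x f) (range I)) (range I)
        (extChartAt I x x) := by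
    rw [fderivWithin_congr (fderivWithin_writtenInExtChartAt_const_mul_add f ha b x)
      (fderivWithin_writtenInExtChartAt_const_mul_add f ha b x hx)]
    exact fderivWithin_const_smul_of_invertible a
      (f := fderivWithin ℝ (writtenInExtChartAt I 𝓘(ℝ, ℝ) x f) (range I)) (I.uniqueDiffOn _ hx)
  ext v w
  simp only [mhessian, h1]
  simp

/-- `d(a · f + b) = a · df` at a point of differentiability. [folklore] -/
theorem mfderiv_const_mul_add {f : M → ℝ} (a b : ℝ) {x : M}
    (hf : MDifferentiableAt I 𝓘(ℝ, ℝ) f x) :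
    mfderiv I 𝓘(ℝ, ℝ) (fun y => a * f y + b) x = a • mfderiv I 𝓘(ℝ, ℝ) f x := by
  have h1 : HasMFDerivAt I 𝓘(ℝ, ℝ) (fun y => a * f y) x (a • mfderiv I 𝓘(ℝ, ℝ) f x) :=
    hf.hasMFDerivAt.const_smul a
  exact (h1.add (hasMFDerivAt_const (I := I) (I' := 𝓘(ℝ, ℝ)) b x)).mfderiv.trans (add_zero _)

/-- `a · f + b` is differentiable where `f` is. [folklore] -/
theorem MDifferentiableAt.const_mul_add {f : M → ℝ} (a b : ℝ) {x : M}
    (hf : MDifferentiableAt I 𝓘(ℝ, ℝ) f x) :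
    MDifferentiableAt I 𝓘(ℝ, ℝ) (fun y => a * f y + b) x := by
  have h1 : MDifferentiableAt I 𝓘(ℝ, ℝ) (fun y => a * f y) x := hf.const_smul a
  exact h1.add (mdifferentiableAt_const (I := I) (I' := 𝓘(ℝ, ℝ)))

/-- `a · f + b` and `f` have the same critical points (`a ≠ 0`). [cite: MilnorHCobordism1965, Thm. 4.8 (alternate version; renormalisation)] -/
theorem isMCriticalPt_const_mul_add_iff {f : M → ℝ} {a : ℝ} (ha : a ≠ 0) (b : ℝ) {x : M}
    (hf : MDifferentiableAt I 𝓘(ℝ, ℝ) f x) :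
    IsMCriticalPt I (fun y => a * f y + b) x ↔ IsMCriticalPt I f x := by
  unfold IsMCriticalPt
  rw [mfderiv_const_mul_add a b hf]
  exact smul_eq_zero_iff_right ha

/-- The critical sets of `a · f + b` and `f` agree (`a ≠ 0`, `f` differentiable). [cite: MilnorHCobordism1965, Thm. 4.8 (alternate version; renormalisation)] -/
theorem criticalSet_const_mul_add {f : M → ℝ} {a : ℝ} (ha : a ≠ 0) (b : ℝ)
    (hf : MDifferentiable I 𝓘(ℝ, ℝ) f) :
    criticalSet I (fun y => a * f y + b) = criticalSet I f :=
  Set.ext fun x => isMCriticalPt_const_mul_add_iff ha b (hf x)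

variable [FiniteDimensional ℝ E]

/-- **The Morse index is unchanged by `f ↦ a · f + b` with `a > 0`** (at every point; both
sides are computed from the chartwise Hessian). [cite: MilnorHCobordism1965, Thm. 4.8 (alternate version; renormalisation)] -/
theorem morseIndex_const_mul_add (f : M → ℝ) {a : ℝ} (ha : 0 < a) (b : ℝ) (x : M) :
    morseIndex I (fun y => a * f y + b) x = morseIndex I f x := by
  unfold morseIndex
  rw [mhessian_const_mul_add f ha.ne' b x]
  have h : (a • mhessian I f x).toQuadraticMap = a • (mhessian I f x).toQuadraticMap := by
    ext v; simp
  rw [h, sigNeg_smul ha]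

omit [FiniteDimensional ℝ E] in
/-- `a · f + b` is a Morse function when `f` is (`a ≠ 0`). [cite: MilnorHCobordism1965, Thm. 4.8 (alternate version; renormalisation)] -/
theorem IsMorse.const_mul_add {f : M → ℝ} (hf : IsMorse I f) {a : ℝ} (ha : a ≠ 0) (b : ℝ) :
    IsMorse I (fun y => a * f y + b) := by
  have hs : ContMDiff I 𝓘(ℝ, ℝ) ∞ (fun y => a * f y + b) :=
    ((contDiff_const.mul contDiff_id).add contDiff_const).comp_contMDiff hf.contMDiff
  refine ⟨hs, fun x hx => ?_⟩
  have hd : MDifferentiableAt I 𝓘(ℝ, ℝ) f x := hf.contMDiff.mdifferentiableAt (by simp)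
  rw [isMCriticalPt_const_mul_add_iff ha b hd] at hx
  rw [mhessian_const_mul_add f ha b]
  obtain ⟨hl, hr⟩ := hf.nondegenerate hx
  refine ⟨fun v hv => hl v fun w => ?_, fun v hv => hr v fun w => ?_⟩
  · have h := hv w
    simp only [LinearMap.smul_apply, smul_eq_mul, mul_eq_zero, ha, false_or] at h
    exact h
  · have h := hv w
    simp only [LinearMap.smul_apply, smul_eq_mul, mul_eq_zero, ha, false_or] at h
    exact h

omit [FiniteDimensional ℝ E] in
/-- Conversely `f` is Morse when `a · f + b` is (`a ≠ 0`): apply the previous lemma with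
`a⁻¹`, `-b/a`. [folklore] -/
theorem IsMorse.of_const_mul_add {f : M → ℝ} {a : ℝ} (ha : a ≠ 0) (b : ℝ)
    (h : IsMorse I (fun y => a * f y + b)) : IsMorse I f := by
  have h' := h.const_mul_add (inv_ne_zero ha) (-(a⁻¹ * b))
  have heq : (fun y => a⁻¹ * (a * f y + b) + -(a⁻¹ * b)) = f := by
    funext y; field_simp; ring
  rwa [heq] at h'

/-- Index bookkeeping: for a Morse function, the critical points of `a · f + b` of index `k`
are those of `f` (`a > 0`). [cite: MilnorHCobordism1965, Thm. 4.8 (alternate version; renormalisation)] -/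
theorem IsMorse.criticalSetOfIndex_const_mul_add {f : M → ℝ} (hf : IsMorse I f) {a : ℝ}
    (ha : 0 < a) (b : ℝ) (k : ℕ) :
    criticalSetOfIndex I (fun y => a * f y + b) k = criticalSetOfIndex I f k := by
  ext x
  simp only [mem_criticalSetOfIndex]
  have hd : MDifferentiableAt I 𝓘(ℝ, ℝ) f x := hf.contMDiff.mdifferentiableAt (by simp)
  rw [isMCriticalPt_const_mul_add_iff ha.ne' b hd, morseIndex_const_mul_add f ha b x]

end General

end Literature.Topology.FourManifolds
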